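import Mathlib.Analysis.Normed.Module.Basic
import Mathlib.Algebra.Order.Floor.Defs
import HarnessLib

/-!
# Square grids in the plane (sup norm): squares, adjacency, edges, skeleton

Elementary plane geometry for the `C⁰` general position of discs with respect to a foliation
(Camacho–Lins Neto, *Geometric Theory of Foliations*, Ch. VI §3): the domain square is cut into
`n × n` congruent closed squares; maps are modified on the **1-skeleton** (the union of the
edges) and then extended over each square by a cone (`TautFoliationsConeSquare.lean`). In the
sup norm of `ℝ × ℝ` every square is a closed ball, its boundary a sphere, which is the form in
which the cone coordinates are written.

* `SquareGrid.Grid` (**definition**): lower-left corner `a`, half-side `ℓ > 0` of the small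
  squares, and their number `n > 0` per side; `Grid.centre q`, `Grid.sq q = closedBall (centre q) ℓ`
  for `q : Fin n × Fin n`, the big square `Grid.S = closedBall bigCentre (n ℓ)`.
* membership in coordinates (`mem_sq_iff`, `mem_S_iff`), `sq_subset_S`, **every point of `S`
  lies in some small square** (`exists_mem_sq`);
* **adjacency** `Grid.Adj` (indices differing by at most one in each coordinate): squares that
  meet are adjacent (`adj_of_inter_nonempty`), an adjacent square lies in the ball of radius
  `3ℓ` about the centre (`sq_subset_closedBall_of_adj`), two steps in radius `5ℓ`;
* the boundary sphere of a small square in coordinates (`mem_sphere_centre_iff`), two distinct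
  squares meet only along their boundaries (`mem_sphere_of_mem_sq_of_ne`);
* the four **edges** `Grid.edge q k : ℝ → ℝ × ℝ` (`k : Fin 4`: bottom, top, left, right),
  affine parametrisations by arc length on `[0, 2ℓ]`, covering the boundary sphere
  (`edge_mem_sphere`, `exists_edge_eq_of_mem_sphere`), shared by adjacent squares
  (`edge_top_eq`, `edge_right_eq`).

All statements are [folklore].
-/

open Set Metric

namespace Literature.Topology.FourManifolds

namespace SquareGrid

/-- A **square grid** in the plane: the big square with lower-left corner `a` and side `2 n ℓ`,
cut into `n × n` closed squares of half-side `ℓ`. [folklore] -/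
structure Grid where
  /-- lower-left corner -/
  a : ℝ × ℝ
  /-- half-side of the small squares -/
  ℓ : ℝ
  /-- number of small squares per side -/
  n : ℕ
  hℓ : 0 < ℓ
  hn : 0 < n

namespace Grid

variable (g : Grid) {x : ℝ × ℝ} {q q' q'' : Fin g.n × Fin g.n}

/-- The centre of the small square of index `q`. [folklore] -/
def centre (q : Fin g.n × Fin g.n) : ℝ × ℝ :=
  (g.a.1 + (2 * (q.1 : ℕ) + 1) * g.ℓ, g.a.2 + (2 * (q.2 : ℕ) + 1) * g.ℓ)

/-- The small closed square of index `q`: the closed sup-norm ball of radius `ℓ` about its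
centre. [folklore] -/
def sq (q : Fin g.n × Fin g.n) : Set (ℝ × ℝ) := closedBall (g.centre q) g.ℓ

/-- The centre of the big square. [folklore] -/
def bigCentre : ℝ × ℝ := (g.a.1 + g.n * g.ℓ, g.a.2 + g.n * g.ℓ)

/-- The big square: the closed sup-norm ball of radius `n ℓ` about its centre. [folklore] -/
def S : Set (ℝ × ℝ) := closedBall g.bigCentre (g.n * g.ℓ)

/-- First coordinate of the centre. [folklore] -/
theorem centre_fst (q : Fin g.n × Fin g.n) : (g.centre q).1 = g.a.1 + (2 * (q.1 : ℕ) + 1) * g.ℓ := rfl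

/-- Second coordinate of the centre. [folklore] -/
theorem centre_snd (q : Fin g.n × Fin g.n) : (g.centre q).2 = g.a.2 + (2 * (q.2 : ℕ) + 1) * g.ℓ := rfl

/-- Sup-norm closed balls of the plane in coordinates. [folklore] -/
theorem mem_closedBall_prod_iff {c : ℝ × ℝ} {r : ℝ} :
    x ∈ closedBall c r ↔ c.1 - r ≤ x.1 ∧ x.1 ≤ c.1 + r ∧ c.2 - r ≤ x.2 ∧ x.2 ≤ c.2 + r := by
  rw [mem_closedBall, Prod.dist_eq, max_le_iff, Real.dist_eq, Real.dist_eq, abs_sub_le_iff,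
    abs_sub_le_iff]
  constructor
  · rintro ⟨⟨h₁, h₂⟩, h₃, h₄⟩; exact ⟨by linarith, by linarith, by linarith, by linarith⟩
  · rintro ⟨h₁, h₂, h₃, h₄⟩; exact ⟨⟨by linarith, by linarith⟩, by linarith, by linarith⟩

/-- **Membership in a small square, in coordinates.** [folklore] -/
theorem mem_sq_iff : x ∈ g.sq q ↔
    g.a.1 + 2 * (q.1 : ℕ) * g.ℓ ≤ x.1 ∧ x.1 ≤ g.a.1 + (2 * (q.1 : ℕ) + 2) * g.ℓ ∧
    g.a.2 + 2 * (q.2 : ℕ) * g.ℓ ≤ x.2 ∧ x.2 ≤ g.a.2 + (2 * (q.2 : ℕ) + 2) * g.ℓ := by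
  rw [sq, mem_closedBall_prod_iff, centre_fst, centre_snd]
  constructor
  · rintro ⟨h₁, h₂, h₃, h₄⟩; exact ⟨by linarith, by linarith, by linarith, by linarith⟩
  · rintro ⟨h₁, h₂, h₃, h₄⟩; exact ⟨by linarith, by linarith, by linarith, by linarith⟩

/-- **Membership in the big square, in coordinates.** [folklore] -/
theorem mem_S_iff : x ∈ g.S ↔
    g.a.1 ≤ x.1 ∧ x.1 ≤ g.a.1 + 2 * g.n * g.ℓ ∧ g.a.2 ≤ x.2 ∧ x.2 ≤ g.a.2 + 2 * g.n * g.ℓ := by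
  rw [S, mem_closedBall_prod_iff]
  simp only [bigCentre]
  constructor
  · rintro ⟨h₁, h₂, h₃, h₄⟩; exact ⟨by linarith, by linarith, by linarith, by linarith⟩
  · rintro ⟨h₁, h₂, h₃, h₄⟩; exact ⟨by linarith, by linarith, by linarith, by linarith⟩

/-- The centre of a small square lies in it. [folklore] -/
theorem centre_mem_sq (q : Fin g.n × Fin g.n) : g.centre q ∈ g.sq q := mem_closedBall_self g.hℓ.le

/-- **Small squares lie in the big square.** [folklore] -/
theorem sq_subset_S (q : Fin g.n × Fin g.n) : g.sq q ⊆ g.S := by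
  intro x hx
  rw [mem_sq_iff] at hx
  rw [mem_S_iff]
  have h₁ : ((q.1 : ℕ) : ℝ) + 1 ≤ g.n := by exact_mod_cast q.1.isLt
  have h₂ : ((q.2 : ℕ) : ℝ) + 1 ≤ g.n := by exact_mod_cast q.2.isLt
  have h₃ : (0 : ℝ) ≤ (q.1 : ℕ) := Nat.cast_nonneg _
  have h₄ : (0 : ℝ) ≤ (q.2 : ℕ) := Nat.cast_nonneg _
  have hℓ := g.hℓ.le
  refine ⟨?_, ?_, ?_, ?_⟩ <;> nlinarith

/-- One-dimensional indexing: a real in `[0, 2 n ℓ]` lies in `[2 i ℓ, (2 i + 2) ℓ]` for some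
`i < n`. [folklore] -/
theorem exists_index {u : ℝ} (hu₀ : 0 ≤ u) (hun : u ≤ 2 * g.n * g.ℓ) :
    ∃ i : Fin g.n, 2 * (i : ℕ) * g.ℓ ≤ u ∧ u ≤ (2 * (i : ℕ) + 2) * g.ℓ := by
  have hℓ := g.hℓ
  set v : ℝ := u / (2 * g.ℓ) with hv
  have hv₀ : 0 ≤ v := div_nonneg hu₀ (by linarith)
  have hvn : v ≤ g.n := by rw [hv, div_le_iff₀ (by linarith)]; linarith
  have huv : u = 2 * g.ℓ * v := by rw [hv]; field_simp
  set i : ℕ := min (g.n - 1) ⌊v⌋₊ with hi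
  have hin : i < g.n := lt_of_le_of_lt (min_le_left _ _) (Nat.sub_lt g.hn one_pos)
  refine ⟨⟨i, hin⟩, ?_, ?_⟩
  · -- `2 i ℓ ≤ u` since `i ≤ ⌊v⌋ ≤ v`
    have : (i : ℝ) ≤ v := le_trans (by exact_mod_cast min_le_right _ _) (Nat.floor_le hv₀)
    show 2 * (i : ℝ) * g.ℓ ≤ u
    rw [huv]; nlinarith
  · show u ≤ (2 * (i : ℝ) + 2) * g.ℓ
    rcases le_total (g.n - 1) ⌊v⌋₊ with h | h
    · -- `i = n - 1`, and `v ≤ n = i + 1`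
      have hi' : i = g.n - 1 := by rw [hi, min_eq_left h]
      have : (i : ℝ) + 1 = g.n := by
        rw [hi']
        have := g.hn
        push_cast [Nat.cast_sub this]
        ring
      rw [huv]; nlinarith
    · -- `i = ⌊v⌋`, and `v < ⌊v⌋ + 1`
      have hi' : i = ⌊v⌋₊ := by rw [hi, min_eq_right h]
      have : v < (i : ℝ) + 1 := by rw [hi']; exact Nat.lt_floor_add_one v
      rw [huv]; nlinarith

/-- **Every point of the big square lies in some small square.** [folklore] -/
theorem exists_mem_sq (hx : x ∈ g.S) : ∃ q, x ∈ g.sq q := by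
  rw [mem_S_iff] at hx
  obtain ⟨i, hi₁, hi₂⟩ := g.exists_index (u := x.1 - g.a.1) (by linarith) (by linarith)
  obtain ⟨j, hj₁, hj₂⟩ := g.exists_index (u := x.2 - g.a.2) (by linarith) (by linarith)
  exact ⟨(i, j), (g.mem_sq_iff).2 ⟨by linarith, by linarith, by linarith, by linarith⟩⟩

/-- The big square is the union of the small squares. [folklore] -/
theorem iUnion_sq : ⋃ q, g.sq q = g.S :=
  Subset.antisymm (iUnion_subset fun q ↦ g.sq_subset_S q) fun _ hx ↦ mem_iUnion.2 (g.exists_mem_sq hx)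

/-! ## Adjacency -/

/-- Two indices are **adjacent** when they differ by at most one in each coordinate (a square
is adjacent to itself and to its eight neighbours). [folklore] -/
def Adj (q q' : Fin g.n × Fin g.n) : Prop :=
  (q.1 : ℕ) ≤ q'.1 + 1 ∧ (q'.1 : ℕ) ≤ q.1 + 1 ∧ (q.2 : ℕ) ≤ q'.2 + 1 ∧ (q'.2 : ℕ) ≤ q.2 + 1

/-- Adjacency is decidable. [folklore] -/
instance (q q' : Fin g.n × Fin g.n) : Decidable (g.Adj q q') := by unfold Adj; infer_instance

/-- Adjacency is reflexive. [folklore] -/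
theorem adj_refl (q : Fin g.n × Fin g.n) : g.Adj q q := ⟨by omega, by omega, by omega, by omega⟩

/-- Adjacency is symmetric. [folklore] -/
theorem Adj.symm (h : g.Adj q q') : g.Adj q' q := ⟨h.2.1, h.1, h.2.2.2, h.2.2.1⟩

/-- **Squares that meet are adjacent.** [folklore] -/
theorem adj_of_inter_nonempty (h : (g.sq q ∩ g.sq q').Nonempty) : g.Adj q q' := by
  obtain ⟨x, hx, hx'⟩ := h
  rw [mem_sq_iff] at hx hx'
  have hℓ := g.hℓ
  obtain ⟨a₁, a₂, a₃, a₄⟩ := hx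
  obtain ⟨b₁, b₂, b₃, b₄⟩ := hx'
  have i₁ : (2 * (q.1 : ℕ) : ℝ) * g.ℓ ≤ (2 * (q'.1 : ℕ) + 2) * g.ℓ := by linarith
  have i₂ : (2 * (q'.1 : ℕ) : ℝ) * g.ℓ ≤ (2 * (q.1 : ℕ) + 2) * g.ℓ := by linarith
  have i₃ : (2 * (q.2 : ℕ) : ℝ) * g.ℓ ≤ (2 * (q'.2 : ℕ) + 2) * g.ℓ := by linarith
  have i₄ : (2 * (q'.2 : ℕ) : ℝ) * g.ℓ ≤ (2 * (q.2 : ℕ) + 2) * g.ℓ := by linarith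
  have j₁ := le_of_mul_le_mul_right i₁ hℓ
  have j₂ := le_of_mul_le_mul_right i₂ hℓ
  have j₃ := le_of_mul_le_mul_right i₃ hℓ
  have j₄ := le_of_mul_le_mul_right i₄ hℓ
  refine ⟨?_, ?_, ?_, ?_⟩
  · have : ((q.1 : ℕ) : ℝ) ≤ (q'.1 : ℕ) + 1 := by linarith
    exact_mod_cast this
  · have : ((q'.1 : ℕ) : ℝ) ≤ (q.1 : ℕ) + 1 := by linarith
    exact_mod_cast this
  · have : ((q.2 : ℕ) : ℝ) ≤ (q'.2 : ℕ) + 1 := by linarith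
    exact_mod_cast this
  · have : ((q'.2 : ℕ) : ℝ) ≤ (q.2 : ℕ) + 1 := by linarith
    exact_mod_cast this

/-- The centres of adjacent squares are at sup distance at most `2ℓ`. [folklore] -/
theorem dist_centre_le_of_adj (h : g.Adj q q') : dist (g.centre q) (g.centre q') ≤ 2 * g.ℓ := by
  have hℓ := g.hℓ
  obtain ⟨h₁, h₂, h₃, h₄⟩ := h
  have e₁ : ((q.1 : ℕ) : ℝ) ≤ (q'.1 : ℕ) + 1 := by exact_mod_cast h₁
  have e₂ : ((q'.1 : ℕ) : ℝ) ≤ (q.1 : ℕ) + 1 := by exact_mod_cast h₂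
  have e₃ : ((q.2 : ℕ) : ℝ) ≤ (q'.2 : ℕ) + 1 := by exact_mod_cast h₃
  have e₄ : ((q'.2 : ℕ) : ℝ) ≤ (q.2 : ℕ) + 1 := by exact_mod_cast h₄
  rw [Prod.dist_eq, max_le_iff, Real.dist_eq, Real.dist_eq, abs_le, abs_le, centre_fst, centre_fst,
    centre_snd, centre_snd]
  refine ⟨⟨?_, ?_⟩, ?_, ?_⟩ <;> nlinarith

/-- **An adjacent square lies in the ball of radius `3ℓ` about the centre.** [folklore] -/
theorem sq_subset_closedBall_of_adj (h : g.Adj q q') : g.sq q' ⊆ closedBall (g.centre q) (3 * g.ℓ) := by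
  intro x hx
  rw [sq, mem_closedBall] at hx
  rw [mem_closedBall]
  calc dist x (g.centre q) ≤ dist x (g.centre q') + dist (g.centre q') (g.centre q) := dist_triangle _ _ _
    _ ≤ g.ℓ + 2 * g.ℓ := add_le_add hx (by rw [dist_comm]; exact g.dist_centre_le_of_adj h)
    _ = 3 * g.ℓ := by ring

/-- A square two adjacency steps away lies in the ball of radius `5ℓ` about the centre.
[folklore] -/
theorem sq_subset_closedBall_of_adj_adj (h : g.Adj q q') (h' : g.Adj q' q'') :
    g.sq q'' ⊆ closedBall (g.centre q) (5 * g.ℓ) := by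
  intro x hx
  rw [sq, mem_closedBall] at hx
  rw [mem_closedBall]
  calc dist x (g.centre q)
      ≤ dist x (g.centre q'') + dist (g.centre q'') (g.centre q') + dist (g.centre q') (g.centre q) :=
        dist_triangle4 _ _ _ _
    _ ≤ g.ℓ + 2 * g.ℓ + 2 * g.ℓ := by
        gcongr
        · rw [dist_comm]; exact g.dist_centre_le_of_adj h'
        · rw [dist_comm]; exact g.dist_centre_le_of_adj h
    _ = 5 * g.ℓ := by ring

/-! ## The boundary of a small square -/

/-- **The boundary sphere of a small square, in coordinates**: the points of the square with a
coordinate on one of its four sides. [folklore] -/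
theorem mem_sphere_centre_iff : x ∈ sphere (g.centre q) g.ℓ ↔ x ∈ g.sq q ∧
    (x.1 = g.a.1 + 2 * (q.1 : ℕ) * g.ℓ ∨ x.1 = g.a.1 + (2 * (q.1 : ℕ) + 2) * g.ℓ ∨
      x.2 = g.a.2 + 2 * (q.2 : ℕ) * g.ℓ ∨ x.2 = g.a.2 + (2 * (q.2 : ℕ) + 2) * g.ℓ) := by
  have hℓ := g.hℓ
  rw [← closedBall_sdiff_ball, mem_sdiff, show closedBall (g.centre q) g.ℓ = g.sq q from rfl,
    and_congr_right_iff]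
  intro hx
  rw [mem_sq_iff] at hx
  rw [mem_ball, Prod.dist_eq, max_lt_iff, Real.dist_eq, Real.dist_eq, abs_sub_lt_iff,
    abs_sub_lt_iff, centre_fst, centre_snd, not_and_or, not_and_or, not_and_or, not_lt, not_lt,
    not_lt, not_lt]
  obtain ⟨h₁, h₂, h₃, h₄⟩ := hx
  constructor
  · rintro ((h | h) | (h | h))
    · exact Or.inr (Or.inl (by linarith))
    · exact Or.inl (by linarith)
    · exact Or.inr (Or.inr (Or.inr (by linarith)))
    · exact Or.inr (Or.inr (Or.inl (by linarith)))
  · rintro (h | h | h | h)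
    · exact Or.inl (Or.inr (by linarith))
    · exact Or.inl (Or.inl (by linarith))
    · exact Or.inr (Or.inr (by linarith))
    · exact Or.inr (Or.inl (by linarith))

/-- The boundary sphere lies in the square. [folklore] -/
theorem sphere_subset_sq (q : Fin g.n × Fin g.n) : sphere (g.centre q) g.ℓ ⊆ g.sq q :=
  sphere_subset_closedBall

/-- **Two distinct small squares meet only along their boundaries.** [folklore] -/
theorem mem_sphere_of_mem_sq_of_ne (hne : q ≠ q') (hx : x ∈ g.sq q) (hx' : x ∈ g.sq q') :
    x ∈ sphere (g.centre q) g.ℓ := by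
  rw [mem_sphere_centre_iff]
  refine ⟨hx, ?_⟩
  have hℓ := g.hℓ
  rw [mem_sq_iff] at hx hx'
  obtain ⟨a₁, a₂, a₃, a₄⟩ := hx
  obtain ⟨b₁, b₂, b₃, b₄⟩ := hx'
  by_contra hcon
  push Not at hcon
  obtain ⟨c₁, c₂, c₃, c₄⟩ := hcon
  -- then `x` is interior in both coordinates, forcing `q = q'`
  have s₁ : g.a.1 + 2 * (q.1 : ℕ) * g.ℓ < x.1 := lt_of_le_of_ne a₁ (Ne.symm c₁)
  have s₂ : x.1 < g.a.1 + (2 * (q.1 : ℕ) + 2) * g.ℓ := lt_of_le_of_ne a₂ c₂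
  have s₃ : g.a.2 + 2 * (q.2 : ℕ) * g.ℓ < x.2 := lt_of_le_of_ne a₃ (Ne.symm c₃)
  have s₄ : x.2 < g.a.2 + (2 * (q.2 : ℕ) + 2) * g.ℓ := lt_of_le_of_ne a₄ c₄
  have t₁ : (2 * (q'.1 : ℕ) : ℝ) * g.ℓ < (2 * (q.1 : ℕ) + 2) * g.ℓ := by linarith
  have t₂ : (2 * (q.1 : ℕ) : ℝ) * g.ℓ < (2 * (q'.1 : ℕ) + 2) * g.ℓ := by linarith
  have t₃ : (2 * (q'.2 : ℕ) : ℝ) * g.ℓ < (2 * (q.2 : ℕ) + 2) * g.ℓ := by linarith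
  have t₄ : (2 * (q.2 : ℕ) : ℝ) * g.ℓ < (2 * (q'.2 : ℕ) + 2) * g.ℓ := by linarith
  have u₁ := lt_of_mul_lt_mul_right t₁ hℓ.le
  have u₂ := lt_of_mul_lt_mul_right t₂ hℓ.le
  have u₃ := lt_of_mul_lt_mul_right t₃ hℓ.le
  have u₄ := lt_of_mul_lt_mul_right t₄ hℓ.le
  have v₁ : ((q'.1 : ℕ) : ℝ) < (q.1 : ℕ) + 1 := by linarith
  have v₂ : ((q.1 : ℕ) : ℝ) < (q'.1 : ℕ) + 1 := by linarith
  have v₃ : ((q'.2 : ℕ) : ℝ) < (q.2 : ℕ) + 1 := by linarith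
  have v₄ : ((q.2 : ℕ) : ℝ) < (q'.2 : ℕ) + 1 := by linarith
  have w₁ : (q'.1 : ℕ) < (q.1 : ℕ) + 1 := by exact_mod_cast v₁
  have w₂ : (q.1 : ℕ) < (q'.1 : ℕ) + 1 := by exact_mod_cast v₂
  have w₃ : (q'.2 : ℕ) < (q.2 : ℕ) + 1 := by exact_mod_cast v₃
  have w₄ : (q.2 : ℕ) < (q'.2 : ℕ) + 1 := by exact_mod_cast v₄
  exact hne (Prod.ext (Fin.ext (by omega)) (Fin.ext (by omega)))

/-! ## Edges -/

/-- The four **edges** of the small square `q`, parametrised affinely by arc length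
`s ∈ [0, 2ℓ]`: `k = 0` bottom (left to right), `1` top (left to right), `2` left (bottom to
top), `3` right (bottom to top). [folklore] -/
def edge (q : Fin g.n × Fin g.n) (k : Fin 4) (s : ℝ) : ℝ × ℝ :=
  match k with
  | 0 => (g.a.1 + 2 * (q.1 : ℕ) * g.ℓ + s, g.a.2 + 2 * (q.2 : ℕ) * g.ℓ)
  | 1 => (g.a.1 + 2 * (q.1 : ℕ) * g.ℓ + s, g.a.2 + (2 * (q.2 : ℕ) + 2) * g.ℓ)
  | 2 => (g.a.1 + 2 * (q.1 : ℕ) * g.ℓ, g.a.2 + 2 * (q.2 : ℕ) * g.ℓ + s)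
  | 3 => (g.a.1 + (2 * (q.1 : ℕ) + 2) * g.ℓ, g.a.2 + 2 * (q.2 : ℕ) * g.ℓ + s)

/-- The bottom edge. [folklore] -/
@[simp] theorem edge_zero (q : Fin g.n × Fin g.n) (s : ℝ) :
    g.edge q 0 s = (g.a.1 + 2 * (q.1 : ℕ) * g.ℓ + s, g.a.2 + 2 * (q.2 : ℕ) * g.ℓ) := rfl

/-- The top edge. [folklore] -/
@[simp] theorem edge_one (q : Fin g.n × Fin g.n) (s : ℝ) :
    g.edge q 1 s = (g.a.1 + 2 * (q.1 : ℕ) * g.ℓ + s, g.a.2 + (2 * (q.2 : ℕ) + 2) * g.ℓ) := rfl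

/-- The left edge. [folklore] -/
@[simp] theorem edge_two (q : Fin g.n × Fin g.n) (s : ℝ) :
    g.edge q 2 s = (g.a.1 + 2 * (q.1 : ℕ) * g.ℓ, g.a.2 + 2 * (q.2 : ℕ) * g.ℓ + s) := rfl

/-- The right edge. [folklore] -/
@[simp] theorem edge_three (q : Fin g.n × Fin g.n) (s : ℝ) :
    g.edge q 3 s = (g.a.1 + (2 * (q.1 : ℕ) + 2) * g.ℓ, g.a.2 + 2 * (q.2 : ℕ) * g.ℓ + s) := rfl

/-- The edges are continuous (affine) curves. [folklore] -/
theorem continuous_edge (q : Fin g.n × Fin g.n) (k : Fin 4) : Continuous (g.edge q k) := by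
  match k with
  | 0 => exact (continuous_const.add continuous_id).prodMk continuous_const
  | 1 => exact (continuous_const.add continuous_id).prodMk continuous_const
  | 2 => exact continuous_const.prodMk (continuous_const.add continuous_id)
  | 3 => exact continuous_const.prodMk (continuous_const.add continuous_id)

/-- **The edges lie on the boundary sphere of the square** (parameters in `[0, 2ℓ]`).
[folklore] -/
theorem edge_mem_sphere (q : Fin g.n × Fin g.n) (k : Fin 4) {s : ℝ} (hs : s ∈ Icc 0 (2 * g.ℓ)) :
    g.edge q k s ∈ sphere (g.centre q) g.ℓ := by
  have hℓ := g.hℓ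
  obtain ⟨hs₀, hs₁⟩ := hs
  rw [mem_sphere_centre_iff, mem_sq_iff]
  match k with
  | 0 =>
    rw [edge_zero]
    exact ⟨⟨by linarith, by linarith, by linarith, by linarith⟩, Or.inr (Or.inr (Or.inl rfl))⟩
  | 1 =>
    rw [edge_one]
    exact ⟨⟨by linarith, by linarith, by linarith, by linarith⟩, Or.inr (Or.inr (Or.inr rfl))⟩
  | 2 =>
    rw [edge_two]
    exact ⟨⟨by linarith, by linarith, by linarith, by linarith⟩, Or.inl rfl⟩
  | 3 =>
    rw [edge_three]
    exact ⟨⟨by linarith, by linarith, by linarith, by linarith⟩, Or.inr (Or.inl rfl)⟩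

/-- The edges lie in the square (parameters in `[0, 2ℓ]`). [folklore] -/
theorem edge_mem_sq (q : Fin g.n × Fin g.n) (k : Fin 4) {s : ℝ} (hs : s ∈ Icc 0 (2 * g.ℓ)) :
    g.edge q k s ∈ g.sq q :=
  g.sphere_subset_sq q (g.edge_mem_sphere q k hs)

/-- **Every boundary point of a square lies on one of its four edges.** [folklore] -/
theorem exists_edge_eq_of_mem_sphere (hx : x ∈ sphere (g.centre q) g.ℓ) :
    ∃ (k : Fin 4) (s : ℝ), s ∈ Icc 0 (2 * g.ℓ) ∧ g.edge q k s = x := by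
  have hℓ := g.hℓ
  rw [mem_sphere_centre_iff, mem_sq_iff] at hx
  obtain ⟨⟨h₁, h₂, h₃, h₄⟩, h | h | h | h⟩ := hx
  · refine ⟨2, x.2 - (g.a.2 + 2 * (q.2 : ℕ) * g.ℓ), ⟨by linarith, by linarith⟩, ?_⟩
    rw [edge_two]; ext <;> simp only <;> linarith
  · refine ⟨3, x.2 - (g.a.2 + 2 * (q.2 : ℕ) * g.ℓ), ⟨by linarith, by linarith⟩, ?_⟩
    rw [edge_three]; ext <;> simp only <;> linarith
  · refine ⟨0, x.1 - (g.a.1 + 2 * (q.1 : ℕ) * g.ℓ), ⟨by linarith, by linarith⟩, ?_⟩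
    rw [edge_zero]; ext <;> simp only <;> linarith
  · refine ⟨1, x.1 - (g.a.1 + 2 * (q.1 : ℕ) * g.ℓ), ⟨by linarith, by linarith⟩, ?_⟩
    rw [edge_one]; ext <;> simp only <;> linarith

/-- **Shared horizontal edge**: the top edge of `(i, j)` is the bottom edge of `(i, j + 1)`.
[folklore] -/
theorem edge_top_eq {i j j' : Fin g.n} (h : (j' : ℕ) = j + 1) :
    g.edge (i, j) 1 = g.edge (i, j') 0 := by
  funext s
  rw [edge_one, edge_zero]
  ext
  · rfl
  · show g.a.2 + (2 * ((j : ℕ) : ℝ) + 2) * g.ℓ = g.a.2 + 2 * ((j' : ℕ) : ℝ) * g.ℓ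
    rw [h]; push_cast; ring

/-- **Shared vertical edge**: the right edge of `(i, j)` is the left edge of `(i + 1, j)`.
[folklore] -/
theorem edge_right_eq {i i' j : Fin g.n} (h : (i' : ℕ) = i + 1) :
    g.edge (i, j) 3 = g.edge (i', j) 2 := by
  funext s
  rw [edge_three, edge_two]
  ext
  · show g.a.1 + (2 * ((i : ℕ) : ℝ) + 2) * g.ℓ = g.a.1 + 2 * ((i' : ℕ) : ℝ) * g.ℓ
    rw [h]; push_cast; ring
  · rfl

/-- The ends of the edges are the corners: bottom and left edges start at the lower-left
corner, bottom ends where right starts, left ends where top starts, top and right end at the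
upper-right corner. [folklore] -/
theorem edge_corners (q : Fin g.n × Fin g.n) :
    g.edge q 0 0 = g.edge q 2 0 ∧ g.edge q 0 (2 * g.ℓ) = g.edge q 3 0 ∧
    g.edge q 2 (2 * g.ℓ) = g.edge q 1 0 ∧ g.edge q 1 (2 * g.ℓ) = g.edge q 3 (2 * g.ℓ) := by
  refine ⟨?_, ?_, ?_, ?_⟩
  · rw [edge_zero, edge_two]; ext <;> simp
  · rw [edge_zero, edge_three]; ext <;> simp; ring
  · rw [edge_two, edge_one]; ext <;> simp; ring
  · rw [edge_one, edge_three]; ext <;> simp <;> ring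

end Grid

end SquareGrid

end Literature.Topology.FourManifolds
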